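import Summits.QuantumFields.YangMills.Theorems.BalabanLadderIRcofEquipartitionSeamUnitDefs
import Summits.QuantumFields.YangMills.Theorems.ConvexGribovBodyNonSimplyConnectedLatticeGapStubSectorMixture
import HarnessLib

/-!
# Line `equipartition_seam` (crux `IRcof`, stmt-QuantumFields-26930) — stub S7 `MixUnits`: its full text, PROVED

`Mix.mixUnits_text` = the statement of stub S7 `MixUnits` of `Cruxes/IRcof/Lines/equipartition_seam.lean` VERBATIM (over the shared unit
predicates of `…EquipartitionSeamUnitDefs`), proved by re-running the LANDED per-torus mixture argument of crux 16405's `mix_core`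
(`mix_blind_at`, `mix_cov_at`, `mix_rate_bounds`; `Theorems/ConvexGribovBodyNonSimplyConnectedLatticeGapStubSectorMixture{,Aux1,Aux3}.lean`)
torus by torus ABOVE the thresholds `S ≥ S₁(β) := max (S_c β) (S_p β) (S_e β) (S_b β)`, with the constant
`C_{AB} = |C_psc A B| + ½ (4 (|C₂ A| + Σ_τ |C₂ (τ A)|)) (4 (|C₂ B| + Σ_τ |C₂ (τ B)|)) + 6 M_A M_B |C_bad|` drawn BEFORE `β` (uniform on the
cofinal set), rate `min (c_p au β) (min 2 1) = c_p au β` once `c_p au β ≤ 1` (`au → 0`), and `β₂ := max` of the five thresholds.  (`mix_core`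
itself cannot be applied: its statement hides the constant behind `∃ C` per `β` and takes threshold-free hypotheses.)  In a file seeing the
skeleton, `theorem mixUnits_holds : MixUnits := Mix.mixUnits_text` closes S7.

HONEST LABEL.  The Yang–Mills mass gap (Clay) is NOT proved; `IRcof` ∕ `IR` 0 ∕ 1; census row 47 class PWP unchanged (walls S3 ∕ S5ᵛ
untouched); nothing continuum ∕ OS ∕ Clay.  Source: ideator `ym-ir-idea-22` g4, workfile `Cruxes/IRcof/Lines/equipartition_seam_MixUnits.lean`
(crux write 11a4c1684aae), verbatim.
-/

set_option autoImplicit false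

noncomputable section

open Filter Topology MeasureTheory
open Literature.MathematicalPhysics.QuantumFieldTheory Literature.MathematicalPhysics.QuantumLattice
open Summit.QuantumFields.YangMills.Theorems.NonSimplyConnectedLatticeGap

namespace Summit.QuantumFields.YangMills.Cruxes.IRcof.EquipartitionSeam

namespace Mix

open Summit.QuantumFields.YangMills.Theorems.FiniteSusceptibilityWeakCoupling.AxisIsotropy (permSpecies permSpecies_F)

/-- **Stub S7 `MixUnits` of `Lines/equipartition_seam.lean` — its text verbatim.** -/
theorem mixUnits_text :
  ∀ (G : Type) [Group G] [TopologicalSpace G] [IsTopologicalGroup G] [CompactSpace G] [MeasurableSpace G]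
    [BorelSpace G], IsCompactSimpleLieGroup G → ∀ (H : Type) [Group H] [TopologicalSpace H] [IsTopologicalGroup H]
    [CompactSpace H] [MeasurableSpace H] [BorelSpace H], IsCompactSimpleLieGroup H → SimplyConnectedSpace H →
    ∀ (π : H →* G), Continuous π → Function.Surjective π → π.ker ≤ Subgroup.center H → (π.ker : Set H).Finite →
    π.ker ≠ ⊥ → ∀ (ρH : LatticeRep H) (r : LatticeRep G) (au : ℝ → ℝ), (∀ β, 0 < au β) →
    Tendsto au atTop (𝓝 0) → ∀ (a : ℝ) (cls : Labelling π), (∀ S : ℕ, TwistSectorInterface π ρH r a S (cls S)) →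
    (∃ (β_c C : ℝ) (S_c : ℝ → ℕ), ∀ β : ℝ, β_c ≤ β → BadUnitOn π r β cls (S_c β) C) →
    (∃ Bset : Set ℝ, (∀ x : ℝ, ∃ β ∈ Bset, x ≤ β) ∧ ∃ (c_p β_p : ℝ) (S_p : ℝ → ℕ), 0 < c_p ∧
      ∀ A B : YMSpecies G, ∃ C : ℝ, ∀ β ∈ Bset, β_p ≤ β → PscUnitOn π r β cls (S_p β) A B C (c_p * au β)) →
    (∃ (β_e : ℝ) (S_e : ℝ → ℕ), ∀ β : ℝ, β_e ≤ β → EquiUnitOn π r β cls (S_e β)) →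
    (∃ (β_b : ℝ) (S_b : ℝ → ℕ), ∀ A : YMSpecies G, ∃ C : ℝ, ∀ β : ℝ, β_b ≤ β →
      EBlindUnitOn π r β cls (S_b β) A C) →
      CoverGapCof π r au := by
  intro G _ _ _ _ _ _ _ H _ _ _ _ _ _ _ _ π hπc _ _ hfin _ ρH r au _ hau0 a cls hI hbad hpsc hequi heblind
  haveI : Fintype ↥π.ker := @Fintype.ofFinite _ hfin.to_subtype
  obtain ⟨β_c, Cbad, S_c, hbad⟩ := hbad
  obtain ⟨Bset, hcof, c_p, β_p, S_p, hc_p, hpsc⟩ := hpsc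
  obtain ⟨β_e, S_e, hequi⟩ := hequi
  obtain ⟨β_b, S_b, heblind⟩ := heblind
  choose Cpsc hCpsc using hpsc
  choose C₂ hC₂ using heblind
  -- beyond `β₀` the per-sector rate `c_p · au β` is the smallest of the three rates
  obtain ⟨β₀, hβ₀⟩ : ∃ β₀ : ℝ, ∀ β, β₀ ≤ β → c_p * au β < 1 := by
    have h := hau0.const_mul c_p
    rw [mul_zero] at h
    exact Filter.eventually_atTop.1 (h.eventually (eventually_lt_nhds one_pos))
  have hρc : Continuous (r.ρ.comp π) := r.continuous.comp hπc
  refine ⟨Bset, hcof, c_p, max (max β_c β_p) (max (max β_e β_b) β₀),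
    fun β => max (max (S_c β) (S_p β)) (max (S_e β) (S_b β)), hc_p, fun A B => ?_⟩
  obtain ⟨MA, hMA⟩ := A.bounded
  obtain ⟨MB, hMB⟩ := B.bounded
  have hMA0 : 0 ≤ MA := (abs_nonneg _).trans (hMA fun _ => 1)
  have hMB0 : 0 ≤ MB := (abs_nonneg _).trans (hMB fun _ => 1)
  refine ⟨|Cpsc A B| + (1 / 2) * ((4 * (|C₂ A| + ∑ τ : Equiv.Perm (Fin 4), |C₂ (permSpecies τ A)|)) *
      (4 * (|C₂ B| + ∑ τ : Equiv.Perm (Fin 4), |C₂ (permSpecies τ B)|))) + 6 * (MA * MB * |Cbad|),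
    fun β hβB hβ₂ S n hS hn => ?_⟩
  -- thresholds in `β`
  have hβc : β_c ≤ β := le_trans (le_trans (le_max_left _ _) (le_max_left _ _)) hβ₂
  have hβp : β_p ≤ β := le_trans (le_trans (le_max_right _ _) (le_max_left _ _)) hβ₂
  have hβe : β_e ≤ β := le_trans (le_trans (le_trans (le_max_left _ _) (le_max_left _ _)) (le_max_right _ _)) hβ₂
  have hβb : β_b ≤ β := le_trans (le_trans (le_trans (le_max_right _ _) (le_max_left _ _)) (le_max_right _ _)) hβ₂
  have hβ0 : β₀ ≤ β := le_trans (le_trans (le_max_right _ _) (le_max_right _ _)) hβ₂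
  -- thresholds in `S`
  have hSc : S_c β ≤ S := le_trans (le_trans (le_max_left _ _) (le_max_left _ _)) hS
  have hSp : S_p β ≤ S := le_trans (le_trans (le_max_right _ _) (le_max_left _ _)) hS
  have hSe : S_e β ≤ S := le_trans (le_trans (le_max_left _ _) (le_max_right _ _)) hS
  have hSb : S_b β ≤ S := le_trans (le_trans (le_max_right _ _) (le_max_right _ _)) hS
  -- the four per-torus inputs at this `β` and this `S`
  set m : ℝ := c_p * au β with hmdef
  have hm1 : m ≤ 1 := (hβ₀ β hβ0).le
  have hCbadS : ((wilsonMeasure (r.ρ.comp π) β : Measure (GaugeConfig 4 (2 * S + 1) H))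
      ((cls S) ⁻¹' {none})).toReal ≤ Cbad * Real.exp (-(1 * (S : ℝ))) := by
    rw [one_mul]; exact hbad β hβc S hSc
  have hPscS := fun z => hCpsc A B β hβB hβp S n z hSp hn
  have hEquiS : ∀ z w : Sector π, (∀ q : Plane, q.1.1 ≠ 0 → z q = w q) →
      |((wilsonMeasure (r.ρ.comp π) β : Measure (GaugeConfig 4 (2 * S + 1) H)) ((cls S) ⁻¹' {some z})).toReal -
        ((wilsonMeasure (r.ρ.comp π) β : Measure (GaugeConfig 4 (2 * S + 1) H)) ((cls S) ⁻¹' {some w})).toReal| ≤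
        1 * Real.exp (-(1 * (2 * (S : ℝ) + 1))) *
          ((wilsonMeasure (r.ρ.comp π) β : Measure (GaugeConfig 4 (2 * S + 1) H)) ((cls S) ⁻¹' {some w})).toReal := by
    intro z w h; rw [one_mul, one_mul]; exact hequi β hβe S z w hSe h
  have hEBS : ∀ (B' : YMSpecies G) (z w : Sector π), (∀ q : Plane, q.1.1 ≠ 0 → z q = w q) →
      |((wilsonMeasure (r.ρ.comp π) β : Measure (GaugeConfig 4 (2 * S + 1) H)) ((cls S) ⁻¹' {some w})).toReal *
          (∫ V in ((cls S) ⁻¹' {some z}), B'.F (fun e => π (torusLift (2 * S + 1) V e))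
            ∂(wilsonMeasure (r.ρ.comp π) β : Measure (GaugeConfig 4 (2 * S + 1) H))) -
        ((wilsonMeasure (r.ρ.comp π) β : Measure (GaugeConfig 4 (2 * S + 1) H)) ((cls S) ⁻¹' {some z})).toReal *
          (∫ V in ((cls S) ⁻¹' {some w}), B'.F (fun e => π (torusLift (2 * S + 1) V e))
            ∂(wilsonMeasure (r.ρ.comp π) β : Measure (GaugeConfig 4 (2 * S + 1) H)))| ≤
        C₂ B' * Real.exp (-(1 * (2 * (S : ℝ) + 1))) *
          ((wilsonMeasure (r.ρ.comp π) β : Measure (GaugeConfig 4 (2 * S + 1) H)) ((cls S) ⁻¹' {some z})).toReal *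
          ((wilsonMeasure (r.ρ.comp π) β : Measure (GaugeConfig 4 (2 * S + 1) H)) ((cls S) ⁻¹' {some w})).toReal := by
    intro B' z w h; rw [one_mul]; exact hC₂ B' β hβb S z w hSb h
  -- the per-torus mixture argument of `mix_core`, verbatim with `μ₁ = μ₂ = c = C₁ = 1`
  haveI := isProbabilityMeasure_wilsonMeasure (d := 4) (L := 2 * S + 1) (r.ρ.comp π) hρc β
  have hcA0 : 0 ≤ 4 * (|C₂ A| + ∑ τ : Equiv.Perm (Fin 4), |C₂ (permSpecies τ A)|) := by positivity
  have hcB0 : 0 ≤ 4 * (|C₂ B| + ∑ τ : Equiv.Perm (Fin 4), |C₂ (permSpecies τ B)|) := by positivity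
  have hblA := mix_blind_at π (r.ρ.comp π) hρc β (cls S) ((hI S).1) ((hI S).2.2.2.2.2.2.2) A 1
    (Real.exp (-(1 * (2 * (S : ℝ) + 1)))) (Real.exp (-(1 * (2 * (S : ℝ) + 1)))) (Real.exp_nonneg _)
    C₂ (fun z => ((wilsonMeasure (r.ρ.comp π) β : Measure (GaugeConfig 4 (2 * S + 1) H))
      ((cls S) ⁻¹' {some z})).toReal)
    (fun B' z => ∫ V in (cls S) ⁻¹' {some z}, B'.F (fun e => π (torusLift (2 * S + 1) V e))
      ∂(wilsonMeasure (r.ρ.comp π) β : Measure (GaugeConfig 4 (2 * S + 1) H)))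
    (fun _ => rfl) (fun _ _ => rfl) hEquiS hEBS
  have hblB := mix_blind_at π (r.ρ.comp π) hρc β (cls S) ((hI S).1) ((hI S).2.2.2.2.2.2.2) B 1
    (Real.exp (-(1 * (2 * (S : ℝ) + 1)))) (Real.exp (-(1 * (2 * (S : ℝ) + 1)))) (Real.exp_nonneg _)
    C₂ (fun z => ((wilsonMeasure (r.ρ.comp π) β : Measure (GaugeConfig 4 (2 * S + 1) H))
      ((cls S) ⁻¹' {some z})).toReal)
    (fun B' z => ∫ V in (cls S) ⁻¹' {some z}, B'.F (fun e => π (torusLift (2 * S + 1) V e))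
      ∂(wilsonMeasure (r.ρ.comp π) β : Measure (GaugeConfig 4 (2 * S + 1) H)))
    (fun _ => rfl) (fun _ _ => rfl) hEquiS hEBS
  have hcov := mix_cov_at π hπc (r.ρ.comp π) hρc β _ rfl (cls S) ((hI S).1) ((hI S).2.2.2.2.1) A B MA MB hMA hMB
    (-Pi.single 0 (n : ℤ)) (|Cpsc A B| * Real.exp (-(m * n)))
    (4 * (|C₂ A| + ∑ τ : Equiv.Perm (Fin 4), |C₂ (permSpecies τ A)|) *
      Real.exp (-(1 * (2 * (S : ℝ) + 1))))
    (4 * (|C₂ B| + ∑ τ : Equiv.Perm (Fin 4), |C₂ (permSpecies τ B)|) *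
      Real.exp (-(1 * (2 * (S : ℝ) + 1))))
    (by positivity) (mul_nonneg hcA0 (Real.exp_nonneg _)) (mul_nonneg hcB0 (Real.exp_nonneg _))
    (fun z => (hPscS z).trans (mul_le_mul_of_nonneg_right
      (mul_le_mul_of_nonneg_right (le_abs_self _) (Real.exp_nonneg _)) ENNReal.toReal_nonneg))
    hblA hblB
  obtain ⟨r1, r2, r3⟩ := mix_rate_bounds m 1 1 one_pos one_pos S n hn
  have hmin : min m (min (2 * (1 : ℝ)) 1) = m := by
    rw [min_eq_left]; exact hm1.trans (by norm_num)
  rw [hmin] at r1 r2 r3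
  have hpn : ((wilsonMeasure (r.ρ.comp π) β : Measure (GaugeConfig 4 (2 * S + 1) H))
      ((cls S) ⁻¹' {none})).toReal ≤ |Cbad| * Real.exp (-(m * n)) :=
    hCbadS.trans ((mul_le_mul_of_nonneg_right (le_abs_self _) (Real.exp_nonneg _)).trans
      (mul_le_mul_of_nonneg_left r3 (abs_nonneg _)))
  unfold latticeConnectedCorr
  refine hcov.trans ?_
  have t2 : (4 * (|C₂ A| + ∑ τ : Equiv.Perm (Fin 4), |C₂ (permSpecies τ A)|) *
      Real.exp (-(1 * (2 * (S : ℝ) + 1)))) *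
      (4 * (|C₂ B| + ∑ τ : Equiv.Perm (Fin 4), |C₂ (permSpecies τ B)|) *
      Real.exp (-(1 * (2 * (S : ℝ) + 1)))) ≤
      (4 * (|C₂ A| + ∑ τ : Equiv.Perm (Fin 4), |C₂ (permSpecies τ A)|)) *
      (4 * (|C₂ B| + ∑ τ : Equiv.Perm (Fin 4), |C₂ (permSpecies τ B)|)) *
      Real.exp (-(m * n)) := by
    calc _ = (4 * (|C₂ A| + ∑ τ : Equiv.Perm (Fin 4), |C₂ (permSpecies τ A)|)) *
          (4 * (|C₂ B| + ∑ τ : Equiv.Perm (Fin 4), |C₂ (permSpecies τ B)|)) *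
          (Real.exp (-(1 * (2 * (S : ℝ) + 1))) * Real.exp (-(1 * (2 * (S : ℝ) + 1)))) := by ring
      _ ≤ _ := mul_le_mul_of_nonneg_left r2 (mul_nonneg hcA0 hcB0)
  have t3 : MA * MB * ((wilsonMeasure (r.ρ.comp π) β : Measure (GaugeConfig 4 (2 * S + 1) H))
      ((cls S) ⁻¹' {none})).toReal ≤ MA * MB * |Cbad| * Real.exp (-(m * n)) := by
    calc _ ≤ MA * MB * (|Cbad| * Real.exp (-(m * n))) :=
          mul_le_mul_of_nonneg_left hpn (mul_nonneg hMA0 hMB0)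
      _ = _ := by ring
  calc _ ≤ |Cpsc A B| * Real.exp (-(m * n)) +
        (1 / 2) * ((4 * (|C₂ A| + ∑ τ : Equiv.Perm (Fin 4), |C₂ (permSpecies τ A)|)) *
          (4 * (|C₂ B| + ∑ τ : Equiv.Perm (Fin 4), |C₂ (permSpecies τ B)|)) * Real.exp (-(m * n))) +
        6 * (MA * MB * |Cbad| * Real.exp (-(m * n))) :=
        add_le_add (add_le_add le_rfl (mul_le_mul_of_nonneg_left t2 (by norm_num)))
          (mul_le_mul_of_nonneg_left t3 (by norm_num))
    _ = _ := by rw [hmdef]; ring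

end Mix

end Summit.QuantumFields.YangMills.Cruxes.IRcof.EquipartitionSeam
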